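import Literature.NumberTheory.LFunctions.Zhang2022.RepairAdmissible
import Literature.NumberTheory.LFunctions.Zhang2022.MainTermFormCauchySchwarz

/-!
# Repair rung F-S1R, barrier side: the structural verdict statement (K-S4) and its frame

Y. Zhang, *Discrete mean estimates and the Landau–Siegel zero*, arXiv:2211.02515v1 (2022)
[Zhang2022LandauSiegel] — an unrefereed manuscript under adjudication; nothing in this file is a
claim about its Theorems 1–2 or about Landau–Siegel zeros.

The cell's ruling R3 (plan of record `repair/p4/Q2-ARCHITECTURE.md`): the BARRIER-IN-CLASS
question of the repair rung (human ruling D-0077) is decided in the JOINT currency of the §2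
endgame — `C₂₃₂(θ)·C₂₃₃(θ) < |𝔡′+𝔡|²(θ)` (the main-order form of Propositions 2.4–2.6 + (2.18),
`Section2MainOrder.MainOrderContradiction` at the printed design) — and the route is STRUCTURAL:
in the audit's main-term dictionary every design's three constants are values of ONE positive
semidefinite Hermitian form `𝔅` on `H¹` profiles (`MainTermFormPSD.mainTermForm`,
`MainTermFormH1.mainTermForm_nonneg_of_isH1`), namely `C₂₃₂ = 𝔅(𝔤,𝔤)`, `C₂₃₃ = 𝔅(f,f)`,
`𝔡′+𝔡 = P(𝔤,f)` for the glued `H`-profile `𝔤` and the probe `f`, so Cauchy–Schwarz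
(`MainTermFormCauchySchwarz.norm_sq_mainTermFormPolar_le`) forbids the joint inequality for every
design at once.

This file supplies the verdict SHAPES, proved from the landed form theory, with the three
dictionary identifications (cell items K-S1: pair blocks, p2; K-S2: the `𝔠₃` slot, p1; K-S3: the
polar cross term, p3) entering as NAMED HYPOTHESES on abstract functionals of the design
`θ : Repair.Theta`; the assembly file (p6) instantiates them with the typed functionals and the
identity theorems as they land, after which the hypotheses of the final theorem are
`AdmissibleTheta θ` only.

## Contents

* profile level (any `H¹` pair `𝔤`, `f`): `not_trueNeed_of_isH1` — `¬ (𝔅(𝔤)·𝔅(f) < ‖P(𝔤,f)‖²)`;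
  `not_printedTriple_of_isH1` — `¬ (𝔅(𝔤) < 1/1000 ∧ 𝔅(f) < 3000 ∧ 25 < ‖P(𝔤,f)‖²)` (the printed
  triple (2.32) `< 0.001`, (2.33) `< 3000`, Prop. 2.4 `> 5`: `0.001·3000 = 3 < 25`);
  `trueNeed_ratio_le_one` — `‖P‖²/(𝔅(𝔤)𝔅(f)) ≤ 1`;
* design level, DICTIONARY FORM (hypotheses `h232`, `h233`, `hsum` = K-S1…S3 and the `H¹`
  witnesses of the design's profiles on the class): `not_repairable_true_need_of_dictionary`,
  `not_printed_chain_of_dictionary`, `margin_nonneg_of_dictionary` (T-zero impossible in class);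
* (the BLOCK-form twins — hypotheses per block `𝔠₁ = 𝔅(g₁)`, `𝔠₂ = 𝔅(g₂)`, `𝔠₃ = P(g₁, R̃g₂)`,
  `𝔡 = P(g₁,f)`, `𝔡′ = P(R̃g₂,f)` — live in the companion file `RepairStructuralBarrierBlocks`, on top
  of the gluing calculus of `RepairGluedForm`);
* Track-V bookkeeping: `thetaW1`, `admissible_thetaW1` — the annex witness `W1` of the cell
  (`ν₁ = 0.50005`, `ν₂ = 1/2`, `ν₃ = 0.499975`, `k = (13/10, 27/10, 13/10)`, `cut₁ = 1/2`; there the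
  DERIVED §18 functional is `< 0.001` while (2.33) fails by a factor `68`) lies in the class — the
  in-class witness that the printed (2.32) alone is attainable only where Proposition 2.4 dies.

Elementary (`nlinarith` on the landed Cauchy–Schwarz and positivity theorems); no new `Prop` facts.
-/

noncomputable section

open MeasureTheory Set
open scoped Real ComplexConjugate

namespace Literature.NumberTheory.LFunctions.Zhang2022

/-! ### Profile level: the two currencies of the §2 endgame are closed by Cauchy–Schwarz -/

variable {g g' f f' : ℝ → ℂ}

/-- **The joint (true-need) inequality fails for every `H¹` design**: `𝔅(𝔤)·𝔅(f) < ‖P(𝔤,f)‖²` is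
impossible (Cauchy–Schwarz for the PSD form `𝔅`; the main-order shape of (2.18) + Props. 2.4–2.6).
[cite: Zhang2022LandauSiegel, §2 (2.18), (2.32)–(2.33)] -/
theorem not_trueNeed_of_isH1 (hg : IsH1OnUnitInterval g g') (hf : IsH1OnUnitInterval f f') :
    ¬ (mainTermForm g g' * mainTermForm f f' < ‖mainTermFormPolar g g' f f'‖ ^ 2) :=
  not_lt.2 (norm_sq_mainTermFormPolar_le hg hf)

/-- The scale-free form: `‖P(𝔤,f)‖² / (𝔅(𝔤)𝔅(f)) ≤ 1` (junk value `0` when the product vanishes).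
[cite: Zhang2022LandauSiegel, §2 (2.18), (2.32)–(2.33)] -/
theorem trueNeed_ratio_le_one (hg : IsH1OnUnitInterval g g') (hf : IsH1OnUnitInterval f f') :
    ‖mainTermFormPolar g g' f f'‖ ^ 2 / (mainTermForm g g' * mainTermForm f f') ≤ 1 := by
  have hcs := norm_sq_mainTermFormPolar_le hg hf
  rcases (mul_nonneg (mainTermForm_nonneg_of_isH1 hg) (mainTermForm_nonneg_of_isH1 hf)).eq_or_lt
    with h0 | hpos
  · rw [← h0, div_zero]; exact zero_le_one
  · rwa [div_le_one hpos]

/-- **The printed triple is infeasible for every `H¹` design**: (2.32) `𝔅(𝔤) < 0.001`, (2.33)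
`𝔅(f) < 3000` and Proposition 2.4's `|𝔡′+𝔡| > 5` (`25 < ‖P(𝔤,f)‖²`) cannot hold together, since
`‖P‖² ≤ 𝔅(𝔤)𝔅(f) < 3 < 25`. [cite: Zhang2022LandauSiegel, §2 Props. 2.4–2.5, (2.32)–(2.33)] -/
theorem not_printedTriple_of_isH1 (hg : IsH1OnUnitInterval g g') (hf : IsH1OnUnitInterval f f') :
    ¬ (mainTermForm g g' < 1 / 1000 ∧ mainTermForm f f' < 3000 ∧
        25 < ‖mainTermFormPolar g g' f f'‖ ^ 2) := by
  rintro ⟨h1, h2, h3⟩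
  have hcs := norm_sq_mainTermFormPolar_le hg hf
  have hg0 := mainTermForm_nonneg_of_isH1 hg
  have hf0 := mainTermForm_nonneg_of_isH1 hf
  nlinarith [mul_le_mul h1.le h2.le hf0 (by norm_num : (0:ℝ) ≤ 1 / 1000)]

/-! ### Design level: the verdict shapes with the dictionary identities as named hypotheses -/

namespace Repair

/-- **K-S4, dictionary form — NOT-REPAIRABLE-IN-CLASS in the joint currency.** Let `C232S`,
`C233S : Theta → ℝ` and `dSumS : Theta → ℂ` be the class functionals of record for
`𝔠₁ + 𝔠₂ + 2 Re 𝔠₃`, for the (2.33) constant and for `𝔡′+𝔡` (the coefficients `ι` are fields of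
`θ`), and let `gl, gl′` (glued `H`-profile) and `fp, fp′` (probe profile) be the design's profiles.
IF on the class the profiles are `H¹` (`hgl`, `hfp`) and the three dictionary identities hold —
`h232 : C232S θ = 𝔅(gl θ)` (K-S1 + K-S2), `h233 : C233S θ = 𝔅(fp θ)` (K-S1), `hsum : dSumS θ =
P(gl θ, fp θ)` (K-S3) — THEN no admissible design satisfies the main-order closing inequality
`C₂₃₂·C₂₃₃ < |𝔡′+𝔡|²`. [cite: Zhang2022LandauSiegel, §2 (2.18), Props. 2.4–2.6, (2.32)–(2.33)] -/
theorem not_repairable_true_need_of_dictionary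
    (C232S C233S : Theta → ℝ) (dSumS : Theta → ℂ) (gl gl' fp fp' : Theta → ℝ → ℂ)
    (hgl : ∀ θ, AdmissibleTheta θ → IsH1OnUnitInterval (gl θ) (gl' θ))
    (hfp : ∀ θ, AdmissibleTheta θ → IsH1OnUnitInterval (fp θ) (fp' θ))
    (h232 : ∀ θ, AdmissibleTheta θ → C232S θ = mainTermForm (gl θ) (gl' θ))
    (h233 : ∀ θ, AdmissibleTheta θ → C233S θ = mainTermForm (fp θ) (fp' θ))
    (hsum : ∀ θ, AdmissibleTheta θ →
      dSumS θ = mainTermFormPolar (gl θ) (gl' θ) (fp θ) (fp' θ)) :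
    ∀ θ, AdmissibleTheta θ → ¬ (C232S θ * C233S θ < ‖dSumS θ‖ ^ 2) := by
  intro θ hθ
  rw [h232 θ hθ, h233 θ hθ, hsum θ hθ]
  exact not_trueNeed_of_isH1 (hgl θ hθ) (hfp θ hθ)

/-- **K-S4, dictionary form — the printed chain is infeasible in class**: no admissible design has
`C₂₃₂ < 0.001` ((2.32)) AND `C₂₃₃ < 3000` ((2.33)) AND `|𝔡′+𝔡|² > 25` (Proposition 2.4) at main
order. [cite: Zhang2022LandauSiegel, §2 Props. 2.4–2.5, (2.32)–(2.33)] -/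
theorem not_printed_chain_of_dictionary
    (C232S C233S : Theta → ℝ) (dSumS : Theta → ℂ) (gl gl' fp fp' : Theta → ℝ → ℂ)
    (hgl : ∀ θ, AdmissibleTheta θ → IsH1OnUnitInterval (gl θ) (gl' θ))
    (hfp : ∀ θ, AdmissibleTheta θ → IsH1OnUnitInterval (fp θ) (fp' θ))
    (h232 : ∀ θ, AdmissibleTheta θ → C232S θ = mainTermForm (gl θ) (gl' θ))
    (h233 : ∀ θ, AdmissibleTheta θ → C233S θ = mainTermForm (fp θ) (fp' θ))
    (hsum : ∀ θ, AdmissibleTheta θ →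
      dSumS θ = mainTermFormPolar (gl θ) (gl' θ) (fp θ) (fp' θ)) :
    ∀ θ, AdmissibleTheta θ →
      ¬ (C232S θ < 1 / 1000 ∧ C233S θ < 3000 ∧ 25 < ‖dSumS θ‖ ^ 2) := by
  intro θ hθ
  rw [h232 θ hθ, h233 θ hθ, hsum θ hθ]
  exact not_printedTriple_of_isH1 (hgl θ hθ) (hfp θ hθ)

/-- **T-zero is impossible in class (dictionary form)**: the §18 margin functional of record is a
value of the PSD form, hence `≥ 0` at every admissible design (no negative direction of the mean
square `Σ𝔠*|H₁+ZH̄₂|²ω` at main order). [cite: Zhang2022LandauSiegel, §2 Lemma 2.3, (2.32)] -/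
theorem margin_nonneg_of_dictionary (C232S : Theta → ℝ) (gl gl' : Theta → ℝ → ℂ)
    (hgl : ∀ θ, AdmissibleTheta θ → IsH1OnUnitInterval (gl θ) (gl' θ))
    (h232 : ∀ θ, AdmissibleTheta θ → C232S θ = mainTermForm (gl θ) (gl' θ)) :
    ∀ θ, AdmissibleTheta θ → 0 ≤ C232S θ := by
  intro θ hθ
  rw [h232 θ hθ]
  exact mainTermForm_nonneg_of_isH1 (hgl θ hθ)

/-! ### Track-V bookkeeping: the annex witness `W1` is in the class -/

/-- The cell's annex witness `W1` (lineages C ≡ S): `ν = (0.50005, 1/2, 0.499975)` (tie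
`ν₃ = 3/4 − ν₁/2`), `k = (13/10, 27/10, 13/10)`, `cut₁ = 1/2`, printed `ι` (the `ι`-value is
immaterial for admissibility). There the derived §18 functional is `< 0.001` while the (2.33)
constant is `≈ 2·10⁵` — (2.32) is bought only by killing (2.33)/Proposition 2.4.
[cite: Zhang2022LandauSiegel, §2 (2.21)–(2.26)] -/
def thetaW1 : Theta where
  nu1 := 10001 / 20000
  nu2 := 1 / 2
  nu3 := 19999 / 40000
  k1 := 13 / 10
  k2 := 27 / 10
  k3 := 13 / 10
  iota2 := iota2
  iota3 := iota3
  iota4 := iota4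
  cut1 := 1 / 2

/-- `W1` is admissible (a FIXED design, however close to the face `ν₁ + ν₃ = 1`, satisfies every
`T`-room clause for all large `D`). [cite: Zhang2022LandauSiegel, §2 (2.21)–(2.26)] -/
theorem admissible_thetaW1 : AdmissibleTheta thetaW1 := by
  unfold AdmissibleTheta Theta.orderedLengths Theta.straddleHalf Theta.belowP
    Theta.dualRangesNonempty Theta.cutAtHalf Theta.shiftsInContour Theta.tiedOuterShifts thetaW1
  norm_num

end Repair

end Literature.NumberTheory.LFunctions.Zhang2022
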